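import Mathlib.Analysis.InnerProductSpace.PiL2
import Mathlib.Analysis.Complex.Basic
import Mathlib.Analysis.Meromorphic.Order
import Mathlib.Tactic

/-!
# A flat `V`-leaf meets the sphere at infinity `H∞` exactly once
(registered helper `helper_flatLeafHCount` of line `cross-cap-laurent`, crux
`GromovRecognitionRelEnd`, item stmt-SmoothPoincare4-11009)

In the wedge cap `X` the sphere at infinity is
`H∞ = {y ∈ U_H | T y = 0} = ηH (ℂ × 0) ∪ {ηC 0}`, where
`U_H = ηH '' D_H ∪ ηC '' D_C` and `T` is the holomorphic cap coordinate near `H∞`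
(`T (ηH p) = p 2 + i p 3` on `D_H = {|(p 2, p 3)| < R₁⁻¹}`).  A flat `V`-leaf `{z₁ = c}`
(`|c| > R₁`) is the two-chart sphere with affine part `u z ∈ range ι` and chart at infinity
`v w = ηH (c.re, c.im, w.re, w.im)` for `|w| < R₁⁻¹` (so `v 0 = ηH (c, 0) ∈ H∞`).  Its intersection
count with `H∞` -- the number of zeros of `T ∘ u` on `u ⁻¹' U_H` counted with multiplicity, plus
the order of `T ∘ v` at `0` when `v 0 ∈ H∞` -- is exactly `1`:

* the first index set is empty: a point of `H∞` is either an `H`-axis point `ηH (a, b, 0, 0)` or the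
  corner `ηC 0`, and neither lies in `range ι`, whereas every `u z` does;
* the second index set is `{0}`: `v 0 = ηH (c.re, c.im, 0, 0) ∈ ηH '' D_H` and `T (v 0) = 0`;
* near `0` one has `(T ∘ v) w = T (ηH (c.re, c.im, w.re, w.im)) = w`, so by locality of the
  meromorphic order (`meromorphicOrderAt_congr`) the order of `T ∘ v` at `0` is the order of `id`
  at `0`, namely `1` (`meromorphicOrderAt_id`).

Everything is proved from Mathlib's `finsum` and meromorphic-order API; no definition, no named fact.

References: D. McDuff, D. Salamon, *J-holomorphic Curves and Symplectic Topology*, 2nd ed. (2012),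
§2.6 and App. E (positivity of intersections, local intersection index as order of vanishing);
M. Gromov, *Pseudo holomorphic curves in symplectic manifolds*, Invent. Math. 82 (1985), 2.4.A₁′.
-/

-- the registered namespace `Summit.SmoothPoincare4.SmoothPoincare4.Theorems…` repeats a component
set_option linter.dupNamespace false

open scoped Topology
open Set Filter

namespace Summit.SmoothPoincare4.SmoothPoincare4.Theorems.GromovRecognitionRelEnd.CrossCapLaurent

/-- **Registered helper `helper_flatLeafHCount`** (line `cross-cap-laurent`, signature verbatim):
a flat `V`-leaf meets `H∞` with intersection count exactly `1`.  With `U_H = ηH '' D_H ∪ ηC '' D_C`,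
`{y ∈ U_H | T y = 0} = ηH (ℂ × 0) ∪ {ηC 0}`, `T (ηH p) = p 2 + i p 3` on `D_H`, an affine part
`u` with values in `range ι` (which misses the `H`-axis points `ηH (·, ·, 0, 0)` and the corner
`ηC 0`) and a chart at infinity `v w = ηH (c.re, c.im, w.re, w.im)` for `|w| < R₁⁻¹`, the sum of the
multiplicities of the zeros of `T ∘ u` in `u ⁻¹' U_H` is `0` (there are none) and the order of
`T ∘ v` at `0` is `1` (`T ∘ v = id` near `0`).  See the file header. [folklore;
cf. McDuff–Salamon 2012, §2.6] -/
theorem helper_flatLeafHCount : ∀ (M : Type) (X : Type) (R₁ : ℝ) (ι : M → X) (ηH ηC : EuclideanSpace ℝ (Fin 4) → X) (T : X → ℂ) (u v : ℂ → X) (c : ℂ), 0 < R₁ → (∀ p : EuclideanSpace ℝ (Fin 4), p 2 ^ 2 + p 3 ^ 2 < R₁⁻¹ ^ 2 → T (ηH p) = ⟨p 2, p 3⟩) → {y : X | y ∈ (ηH '' {p : EuclideanSpace ℝ (Fin 4) | p 2 ^ 2 + p 3 ^ 2 < R₁⁻¹ ^ 2} ∪ ηC '' {p : EuclideanSpace ℝ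 (Fin 4) | p 0 ^ 2 + p 1 ^ 2 < R₁⁻¹ ^ 2 ∧ p 2 ^ 2 + p 3 ^ 2 < R₁⁻¹ ^ 2}) ∧ T y = 0} = Set.range (fun z : ℂ => ηH (WithLp.toLp 2 ![z.re, z.im, 0, 0])) ∪ {ηC 0} → (∀ z : ℂ, u z ∈ Set.range ι) → (∀ w : ℂ, w.re ^ 2 + w.im ^ 2 < R₁⁻¹ ^ 2 → v w = ηH (WithLp.toLp 2 ![c.re, c.im, w.re, w.im])) → (∀ p : EuclideanSpace ℝ (Fin 4), p 2 = 0 → p 3 = 0 → ηH p ∉ Set.range ι) → ηC 0 ∉ Set.range ι → (∑ᶠ z ∈ {z : ℂ | u z ∈ (ηH '' {p : EuclideanSpace ℝ (Fin 4) | p 2 ^ 2 + p 3 ^ 2 < R₁⁻¹ ^ 2} ∪ ηC '' {p : EuclideanSpace ℝ (Fin 4) | p 0 ^ 2 + p 1 ^ 2 < R₁⁻¹ ^ 2 ∧ p 2 ^ 2 + p 3 ^ 2 < R₁⁻¹ ^ 2}) ∧ T (u z) = 0}, (meromorphicOrderAt (T ∘ u) z).untop₀) + (∑ᶠ w ∈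 {w : ℂ | w = 0 ∧ v w ∈ (ηH '' {p : EuclideanSpace ℝ (Fin 4) | p 2 ^ 2 + p 3 ^ 2 < R₁⁻¹ ^ 2} ∪ ηC '' {p : EuclideanSpace ℝ (Fin 4) | p 0 ^ 2 + p 1 ^ 2 < R₁⁻¹ ^ 2 ∧ p 2 ^ 2 + p 3 ^ 2 < R₁⁻¹ ^ 2}) ∧ T (v w) = 0}, (meromorphicOrderAt (T ∘ v) w).untop₀) = 1 := by
  intro M X R₁ ι ηH ηC T u v c hR₁ hTH hzero hu hv hHax hC0
  -- the two chart domains and the neighbourhood `U_H` of `H∞`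
  set DH : Set (EuclideanSpace ℝ (Fin 4)) :=
    {p : EuclideanSpace ℝ (Fin 4) | p 2 ^ 2 + p 3 ^ 2 < R₁⁻¹ ^ 2} with hDH
  set DC : Set (EuclideanSpace ℝ (Fin 4)) :=
    {p : EuclideanSpace ℝ (Fin 4) | p 0 ^ 2 + p 1 ^ 2 < R₁⁻¹ ^ 2 ∧ p 2 ^ 2 + p 3 ^ 2 < R₁⁻¹ ^ 2}
    with hDC
  have hR : (0 : ℝ) < R₁⁻¹ ^ 2 := by positivity
  -- (1) the affine part `u` misses `H∞`: the first index set is empty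
  have h1 : {z : ℂ | u z ∈ (ηH '' DH ∪ ηC '' DC) ∧ T (u z) = 0} = ∅ := by
    refine Set.eq_empty_of_forall_notMem fun z hz => ?_
    have hmem : u z ∈ Set.range (fun z : ℂ => ηH (WithLp.toLp 2 ![z.re, z.im, 0, 0])) ∪ {ηC 0} := by
      rw [← hzero]
      exact hz
    rcases hmem with ⟨a, ha⟩ | h0
    · -- an `H`-axis point `ηH (a.re, a.im, 0, 0)` is not in `range ι`
      have hi : u z ∈ Set.range ι := hu z
      rw [← ha] at hi
      exact hHax (WithLp.toLp 2 ![a.re, a.im, 0, 0]) (by simp) (by simp) hi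
    · -- the corner `ηC 0` is not in `range ι`
      rw [Set.mem_singleton_iff] at h0
      have hi : u z ∈ Set.range ι := hu z
      rw [h0] at hi
      exact hC0 hi
  -- (2) the point at infinity `v 0 = ηH (c.re, c.im, 0, 0)` lies on `H∞`: the second index set is `{0}`
  have hv0 : v 0 = ηH (WithLp.toLp 2 ![c.re, c.im, 0, 0]) := by
    rw [hv 0 (by simpa using hR)]
    simp
  have hp0 : (WithLp.toLp 2 ![c.re, c.im, 0, 0] : EuclideanSpace ℝ (Fin 4)) ∈ DH := by
    simp only [hDH, Set.mem_setOf_eq]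
    simpa using hR
  have h2 : {w : ℂ | w = 0 ∧ v w ∈ (ηH '' DH ∪ ηC '' DC) ∧ T (v w) = 0} = {0} := by
    ext w
    simp only [Set.mem_setOf_eq, Set.mem_singleton_iff]
    constructor
    · exact fun h => h.1
    · rintro rfl
      refine ⟨rfl, ?_, ?_⟩
      · rw [hv0]
        exact Or.inl ⟨_, hp0, rfl⟩
      · rw [hv0, hTH _ hp0]
        simp [Complex.ext_iff]
  -- (3) near `0`, `T ∘ v = id`, so the order of `T ∘ v` at `0` is `1`
  have h3 : meromorphicOrderAt (T ∘ v) 0 = 1 := by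
    have hopen : IsOpen {w : ℂ | w.re ^ 2 + w.im ^ 2 < R₁⁻¹ ^ 2} :=
      isOpen_lt (by fun_prop) continuous_const
    have h0mem : (0 : ℂ) ∈ {w : ℂ | w.re ^ 2 + w.im ^ 2 < R₁⁻¹ ^ 2} := by
      rw [Set.mem_setOf_eq]
      simpa using hR
    have hE : (T ∘ v) =ᶠ[𝓝 (0 : ℂ)] id := by
      filter_upwards [hopen.mem_nhds h0mem] with w hw
      have hwD : (WithLp.toLp 2 ![c.re, c.im, w.re, w.im] : EuclideanSpace ℝ (Fin 4)) ∈ DH := by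
        simp only [hDH, Set.mem_setOf_eq]
        simpa using hw
      simp only [Function.comp_apply, id]
      rw [hv w hw, hTH _ hwD]
      apply Complex.ext <;> simp
    rw [meromorphicOrderAt_congr (hE.filter_mono nhdsWithin_le_nhds), meromorphicOrderAt_id]
  -- assemble: `0 + 1 = 1`
  rw [h1, h2, finsum_mem_empty, finsum_mem_singleton, h3, zero_add]
  rfl

end Summit.SmoothPoincare4.SmoothPoincare4.Theorems.GromovRecognitionRelEnd.CrossCapLaurent
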